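import Summits.QuantumFields.YangMills.Theorems.QuantileBitRingTraceDefs
import HarnessLib

/-!
# Twisted seam sectors of the zero-flux thermal ring and the gauge-averaged bond kernel — definitions

Defs module (D-0009: definitions in `Theorems/` are reviewed) for the SECTOR DOOR of LINE g12-B of seat ym-idea-4
(`QuantileBitPurity.HolonomyQuantileSubQuartic`, item stmt-QuantumFields-23948; memo HOME `bc/g14-dw/SECTORS-translates.md`).
The tree's two-insertion ring trace `TT.ringInsTrace L β n O m` (`Theorems/QuantileBitRingTraceDefs.lean`) closes the chain of
`n+1` transfer kernels through the physical average `physAvg f U = (1/8) Σ_{z ∈ (ℤ/2)³} ∫ f(g · tw_z U) dg`.  Unfolding that average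
splits every slice weight into EIGHT SEAM SECTORS labelled by the centre twist `z` ('t Hooft's temporal twists = electric-flux characters):

* `TT.sectorWeight β n z F = ∫ dg ∫ dU⃗ (∏_{i<n} K_β(U_i, U_{i+1})) · K_β(U_n, g · tw_z U_0) · F(U⃗, g)` — the weight of a bounded functional
  `F` of the slices AND the seam gauge field in the sector `z` (so `ringInsTrace L β n 𝟙_A 0 = (1/8) Σ_z sectorWeight β n z 𝟙_A(U_0)`,
  companion module `QuantileBitPuritySectors`);
* `TT.gaugeKernel β U V = ∫ K_β(U, g · V) dg` — the GAUGE-averaged (NOT twist-averaged) bond kernel, the kernel of `K_β P_G = P_G K_β`,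
  `P_G` the projection onto gauge-invariant (all-flux) functions; `sectorWeight β n z 1 = ∫ dU⃗ ∏ K_β · gaugeKernel β U_n (tw_z U_0)` is the
  twisted partition function `Tr(T_z P_G 𝕂_β^{n+1})` of the sector (companion module `QuantileBitPuritySectorTwistBound`: `≤` the untwisted one).

DEFINITIONS ONLY (+ two `rfl`-level sanity lemmas).  HONEST FRAMING: fixed-lattice bookkeeping objects; nothing about infinite volume, the
continuum limit or the Clay gap.  References: [cite: tHooft1979] (twists ∕ electric flux); [cite: Luscher1983, §2]; [cite: MontvayMunster1994, (3.145)].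
-/

set_option autoImplicit false

noncomputable section

open MeasureTheory
open Literature.MathematicalPhysics.QuantumFieldTheory
open Literature.MathematicalPhysics.QuantumLattice
open scoped BigOperators

namespace Summit.QuantumFields.YangMills.Theorems.FemtoTransferGap.TT

open Summit.QuantumFields.YangMills.Theorems.FemtoTransferGap

variable {L : ℕ} [NeZero L]

/-- **The gauge-averaged bond kernel** `K_β^G(U, V) = ∫ K_β(U, g · V) dg` (Haar probability on the gauge group): the kernel of
`K_β P_G = P_G K_β`, `P_G` the orthogonal projection onto gauge-invariant functions of the spatial links (ALL electric-flux sectors kept —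
contrast the tree's `physKernel`, which also averages the three centre twists). [cite: Luscher1983, §2] [cite: SeilerLNP1982, §3] -/
def gaugeKernel (β : ℝ) (U V : GaugeConfig 3 L SU2) : ℝ :=
  ∫ g, transferKernel su2Rep β U (gaugeTransform g V) ∂gaugeMeasure L

/-- **The weight of the seam sector `z ∈ (ℤ/2)³`**: the open chain of `n` transfer kernels on the slices `U_0, …, U_n`, closed through the
seam bond `K_β(U_n, g · tw_z U_0)` with seam gauge field `g` and centre twist `tw_z`, integrated against a functional `F(U⃗, g)` of the slices
and the seam field (`g` outermost).  `(1/8) Σ_z` of these is the corresponding `physAvg`-closed ring integral. [cite: tHooft1979] [cite: MontvayMunster1994, (3.145)] -/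
def sectorWeight (β : ℝ) (n : ℕ) (z : Fin 3 → Bool)
    (F : (Fin (n + 1) → GaugeConfig 3 L SU2) → (Site 3 L → SU2) → ℝ) : ℝ :=
  ∫ g, ∫ Us : Fin (n + 1) → GaugeConfig 3 L SU2,
    (∏ i : Fin n, transferKernel su2Rep β (Us i.castSucc) (Us i.succ)) *
      transferKernel su2Rep β (Us (Fin.last n)) (gaugeTransform g (twist3 z (Us 0))) * F Us g
    ∂(Measure.pi fun _ : Fin (n + 1) => configMeasure SU2 L) ∂gaugeMeasure L

/-- `gaugeKernel` unfolded. [folklore] -/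
theorem gaugeKernel_apply (β : ℝ) (U V : GaugeConfig 3 L SU2) :
    gaugeKernel β U V = ∫ g, transferKernel su2Rep β U (gaugeTransform g V) ∂gaugeMeasure L := rfl

/-- `sectorWeight` unfolded. [folklore] -/
theorem sectorWeight_apply (β : ℝ) (n : ℕ) (z : Fin 3 → Bool)
    (F : (Fin (n + 1) → GaugeConfig 3 L SU2) → (Site 3 L → SU2) → ℝ) :
    sectorWeight β n z F = ∫ g, ∫ Us : Fin (n + 1) → GaugeConfig 3 L SU2,
      (∏ i : Fin n, transferKernel su2Rep β (Us i.castSucc) (Us i.succ)) *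
        transferKernel su2Rep β (Us (Fin.last n)) (gaugeTransform g (twist3 z (Us 0))) * F Us g
      ∂(Measure.pi fun _ : Fin (n + 1) => configMeasure SU2 L) ∂gaugeMeasure L := rfl

end Summit.QuantumFields.YangMills.Theorems.FemtoTransferGap.TT

end
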